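import Summits.QuantumFields.YangMills.Theorems.FluctuationComparisonRegPrIntLWregChartChainLetters
import Summits.QuantumFields.YangMills.Theorems.FluctuationComparisonRegPrIntLWregChartChainCovariance
import Literature.MathematicalPhysics.QuantumFieldTheory.Balaban1983to89.T4AveragingDisintegration
import Literature.MathematicalPhysics.QuantumFieldTheory.Balaban1983to89.B12SmallFieldDomain259
import Literature.MathematicalPhysics.QuantumFieldTheory.Balaban1983to89.T3ContinuumYM3Torus
import Literature.MathematicalPhysics.QuantumFieldTheory.Balaban1983to89.T3UnitLawDensityEML
import HarnessLib

/-!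
# LINE g18-2 «wreg_chart» (20520 organ WREG) — EDGE engine, part 4 (assembly): stub EDGE `EdgeFlat` — for a FIXED group element `v` and bond `c`, the
# environments `z` for which `v` lies ON THE EDGE of the image window of the chain form a `fieldMeasure`-null set

Cell `ym3-torus`, width seat `ym3-torus-px17` g6 (helper of `stmt-QuantumFields-20520` = `UnitScaleTilt.FluctuationComparisonRegPrIntL`, `--supports`,
count-neutral).  Theorems-side twin of the chart-free stub `stub_edgeFlat : EdgeFlat` of the ideator seat ym-r3-idea-1 g18's
`Cruxes/FluctuationComparisonRegPrIntL/Lines/wreg_chart.lean` (v15 :2304∕:2719, text identical to v14 :1953), with the Cruxes-local chain objects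
`iterCentralBond` ∕ `chainMap ℰp` ∕ `chainWindow α` abstracted to families `icb` ∕ `cm` ∕ `cw` under their recursion equations (each `rfl` for the line's
definitions: `edgeFlat_of_chainEqns (fun P n => iterCentralBond n) (fun P n => chainMap ℰp n) (fun P α n => chainWindow α n) (fun _ _ => rfl) …`).

THE PROOF (no analyticity of the inverse chart; parts 1–3 BY NAME).  Fix `n ≤ m + K`, the chart regime, `c`, `v`.  (i) For EVERY environment `z` the image
window `T_z = cm n z c '' cw n z c` is closed with Haar-null frontier (part 2, ★★★`isClosed_image_and_haar_diff_interior_eq_zero`).  (ii) The set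
`M = {(z, w) | w ∈ T_z ∖ interior T_z}` is measurable: `{(z, w) | w ∈ T_z}` is the image of the jointly measurable iterated window under the injective measurable
map `(z, g) ↦ (z, cm n z c g)` (Lusin–Souslin), and `w ∈ interior T_z` is a countable Boolean combination of such sections through a countable basis and a
countable dense set (`T_z` closed) — §1.  (iii) A gauge transformation `a` concentrated at `c₋` on `T⁽ⁿ⁾` lifts to a fine one `u_a` preserving `fieldMeasure`
with `T_{z^{u_a}} = a·T_z` (part 3), so `(z^{u_a}, w) ∈ M ↔ (z, a⁻¹w) ∈ M`, and `w ↦ a⁻¹w` is transitive; part 1's engine gives `fieldMeasure{z | (z, v) ∈ M} = 0`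
for EVERY `v` — §2; §3 is the T³∕SU(2) statement in the stub's letters.

HONEST FRAMING.  Measure theory and gauge algebra over landed N09∕B12 letters; nothing of Bałaban's is asserted; the smallness ∕ gap numerics on `α` stay
DISPLAYED hypotheses exactly as in the stub; WREG, S2β, the organ, `FluctuationComparisonRegPrIntL` (20520) and every other crux are NOT proved; rung R3 =
YM₃ on T³ — NOT d = 4, NOT infinite volume, NOT a mass gap, NOT Clay.
-/

noncomputable section

open MeasureTheory Set Function Filter Topology
open scoped ENNReal NNReal
open Literature.MathematicalPhysics.QuantumFieldTheory.Balaban1983to89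
open Literature.MathematicalPhysics.QuantumFieldTheory.Balaban1983to89.T3ContinuumYM3Torus (T3Family)
open Literature.MathematicalPhysics.QuantumFieldTheory.Balaban1983to89.T3UnitLawDensityEML (ℰp)
open Literature.MathematicalPhysics.QuantumFieldTheory.Balaban1983to89.Node00 (SU)
open Literature.MathematicalPhysics.QuantumFieldTheory.Balaban1983to89.ExpMeanLog (expMeanLogSU deltaSU)
open Literature.MathematicalPhysics.QuantumFieldTheory.Balaban1983to89.BlockAveraging (Idx avgFun)
open Literature.MathematicalPhysics.QuantumFieldTheory.Balaban1983to89.BlockAveragingHaarAC (centralBond pre post)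
open Literature.MathematicalPhysics.QuantumFieldTheory.Balaban1983to89.BlockAveragingEMLHaarAC (fibreFamily offCard)
open Literature.MathematicalPhysics.QuantumFieldTheory.Balaban1983to89.B12RTGaugeInvariance254 (measurePreserving_gaugeAct)
open Summit.QuantumFields.YangMills.Theorems.FluctuationComparisonRegPrIntLWregChartEdgeEngine (measure_section_eq_zero_of_ae_null_of_transitive)
open Summit.QuantumFields.YangMills.Theorems.FluctuationComparisonRegPrIntLWregChartChainLetters (measurable_cm_prod measurableSet_cw_prod injOn_cm
  isClosed_image_and_haar_diff_interior_eq_zero)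
open Summit.QuantumFields.YangMills.Theorems.FluctuationComparisonRegPrIntLWregChartChainCovariance (exists_fineLift image_cw_gaugeAct)

namespace Summit.QuantumFields.YangMills.Theorems.FluctuationComparisonRegPrIntLWregChartEdge

/-! ## §1  Measurability of the image-window graph and of its frontier graph -/

section Generic

variable {P : Params} {N : ℕ} [NeZero N]
  (icb : (n : ℕ) → PBond P n → PBond P 0)
  (cm : (n : ℕ) → GaugeField P 0 (SU N) → PBond P n → SU N → SU N)
  (cw : (n : ℕ) → GaugeField P 0 (SU N) → PBond P n → Set (SU N))

/-- ★ **THE IMAGE-WINDOW GRAPH `{(z, w) | w ∈ cm n z c '' cw n z c}` IS MEASURABLE** (`n ≤ m + K`, injectivity regime): it is the image of the jointly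
measurable iterated window under the injective measurable fibred map `(z, g) ↦ (z, cm n z c g)` — Lusin–Souslin on the standard Borel space
`(T⁽⁰⁾ → SU(N)) × SU(N)`. [cite: Kechris1995, Thm 15.1] -/
theorem measurableSet_imageGraph {α : ℝ} (hα0 : 0 ≤ α) (hα24 : α ≤ 1 / 24) (hα64 : 64 * α ≤ deltaSU (Fin N))
    (hgap : ∀ j (c : PBond P (j + 1)), (offCard c : ℝ) / (Fintype.card (Idx P) : ℝ) + 150 * α < 1)
    (hicb0 : ∀ c, icb 0 c = c) (hicbS : ∀ n (c : PBond P (n + 1)), icb (n + 1) c = icb n (centralBond c))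
    (hcm : ∀ n U c g, cm n U c g =
      Averaging.iter (fun i => BlockAveraging.blockAvg (P := P) (j := i) (expMeanLogSU (n := Fin N))) n (update U (icb n c) g) c)
    (hcw0 : ∀ U c, cw 0 U c = univ)
    (hcwS : ∀ n U (c : PBond P (n + 1)), cw (n + 1) U c = {g | g ∈ cw n U (centralBond c) ∧
      cm n U (centralBond c) g ∈ {h : SU N | ∀ i : Idx P,
        dist1 (fibreFamily (Averaging.iter (fun i => BlockAveraging.blockAvg (P := P) (j := i) (expMeanLogSU (n := Fin N))) n U) c
          (pre (Averaging.iter (fun i => BlockAveraging.blockAvg (P := P) (j := i) (expMeanLogSU (n := Fin N))) n U) c * h *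
            post (Averaging.iter (fun i => BlockAveraging.blockAvg (P := P) (j := i) (expMeanLogSU (n := Fin N))) n U) c) i) ≤ α}})
    {n : ℕ} (hn : n ≤ P.m + P.K) (c : PBond P n) :
    MeasurableSet {p : GaugeField P 0 (SU N) × SU N | p.2 ∈ cm n p.1 c '' cw n p.1 c} := by
  have hS := measurableSet_cw_prod icb cm cw hcm hcw0 hcwS n c
  have hΦ : Measurable fun q : GaugeField P 0 (SU N) × SU N => (q.1, cm n q.1 c q.2) :=
    measurable_fst.prodMk (measurable_cm_prod icb cm hcm n c)
  have hinj : InjOn (fun q : GaugeField P 0 (SU N) × SU N => (q.1, cm n q.1 c q.2)) {q | q.2 ∈ cw n q.1 c} := by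
    rintro ⟨z, g⟩ hg ⟨z', g'⟩ hg' h
    simp only [Prod.mk.injEq] at h
    obtain ⟨rfl, h2⟩ := h
    exact Prod.ext rfl (injOn_cm icb cm cw hα0 hα24 hα64 hgap hicb0 hicbS hcm hcwS hn z c hg hg' h2)
  have hset : {p : GaugeField P 0 (SU N) × SU N | p.2 ∈ cm n p.1 c '' cw n p.1 c} =
      (fun q : GaugeField P 0 (SU N) × SU N => (q.1, cm n q.1 c q.2)) '' {q | q.2 ∈ cw n q.1 c} := by
    ext ⟨z, w⟩
    simp only [mem_setOf_eq, mem_image, Prod.mk.injEq, Prod.exists]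
    constructor
    · rintro ⟨g, hg, rfl⟩; exact ⟨z, g, hg, rfl, rfl⟩
    · rintro ⟨z', g, hg, rfl, rfl⟩; exact ⟨g, hg, rfl⟩
  rw [hset]
  exact hS.image_of_measurable_injOn hΦ hinj

/-- ★ **THE FRONTIER GRAPH `{(z, w) | w ∈ T_z ∖ interior T_z}` IS MEASURABLE** (`n ≤ m + K`, chart regime): `T_z` is closed for every `z` (part 2), so
`w ∈ interior T_z ↔ ∃ basic open b ∋ w, ∀ d ∈ D ∩ b, d ∈ T_z` for a countable basis and a countable dense `D` — a countable Boolean combination of sections of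
the measurable image-window graph. [folklore] -/
theorem measurableSet_frontierGraph {α : ℝ} (hα0 : 0 < α) (hα24 : α ≤ 1 / 24) (hα64 : 64 * α ≤ deltaSU (Fin N))
    (hαL : 157 * α < ((P.L : ℝ) ^ (P.d - 1))⁻¹)
    (hgap : ∀ j (c : PBond P (j + 1)), (offCard c : ℝ) / (Fintype.card (Idx P) : ℝ) + 150 * α < 1)
    (hicb0 : ∀ c, icb 0 c = c) (hicbS : ∀ n (c : PBond P (n + 1)), icb (n + 1) c = icb n (centralBond c))
    (hcm : ∀ n U c g, cm n U c g =
      Averaging.iter (fun i => BlockAveraging.blockAvg (P := P) (j := i) (expMeanLogSU (n := Fin N))) n (update U (icb n c) g) c)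
    (hcw0 : ∀ U c, cw 0 U c = univ)
    (hcwS : ∀ n U (c : PBond P (n + 1)), cw (n + 1) U c = {g | g ∈ cw n U (centralBond c) ∧
      cm n U (centralBond c) g ∈ {h : SU N | ∀ i : Idx P,
        dist1 (fibreFamily (Averaging.iter (fun i => BlockAveraging.blockAvg (P := P) (j := i) (expMeanLogSU (n := Fin N))) n U) c
          (pre (Averaging.iter (fun i => BlockAveraging.blockAvg (P := P) (j := i) (expMeanLogSU (n := Fin N))) n U) c * h *
            post (Averaging.iter (fun i => BlockAveraging.blockAvg (P := P) (j := i) (expMeanLogSU (n := Fin N))) n U) c) i) ≤ α}})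
    {n : ℕ} (hn : n ≤ P.m + P.K) (c : PBond P n) :
    MeasurableSet {p : GaugeField P 0 (SU N) × SU N |
      p.2 ∈ cm n p.1 c '' cw n p.1 c ∧ p.2 ∉ interior (cm n p.1 c '' cw n p.1 c)} := by
  have h1 := measurableSet_imageGraph icb cm cw hα0.le hα24 hα64 hgap hicb0 hicbS hcm hcw0 hcwS hn c
  have hclosed : ∀ z : GaugeField P 0 (SU N), IsClosed (cm n z c '' cw n z c) := fun z =>
    (isClosed_image_and_haar_diff_interior_eq_zero icb cm cw hα0 hα24 hα64 hαL hgap hicb0 hicbS hcm hcw0 hcwS hn z c).1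
  obtain ⟨B, hBcount, -, hBbasis⟩ := TopologicalSpace.exists_countable_basis (SU N)
  obtain ⟨D, hDcount, hDdense⟩ := TopologicalSpace.exists_countable_dense (SU N)
  -- interior of a CLOSED set through the countable basis and the countable dense set
  have hint : ∀ (z : GaugeField P 0 (SU N)) (w : SU N), w ∈ interior (cm n z c '' cw n z c) ↔
      ∃ b ∈ B, w ∈ b ∧ ∀ d ∈ D, d ∈ b → d ∈ cm n z c '' cw n z c := by
    intro z w
    constructor
    · intro hw
      obtain ⟨b, hb, hwb, hbT⟩ := hBbasis.exists_subset_of_mem_open hw isOpen_interior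
      exact ⟨b, hb, hwb, fun d _ hd => interior_subset (hbT hd)⟩
    · rintro ⟨b, hb, hwb, hD⟩
      have hbo : IsOpen b := hBbasis.isOpen hb
      have hbT : b ⊆ cm n z c '' cw n z c := fun x hx =>
        (hclosed z).closure_subset_iff.2 (fun y hy => hD y hy.2 hy.1) (hDdense.open_subset_closure_inter hbo hx)
      exact mem_interior.2 ⟨b, hbT, hbo, hwb⟩
  have hset : {p : GaugeField P 0 (SU N) × SU N | p.2 ∈ cm n p.1 c '' cw n p.1 c ∧ p.2 ∉ interior (cm n p.1 c '' cw n p.1 c)} =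
      {p : GaugeField P 0 (SU N) × SU N | p.2 ∈ cm n p.1 c '' cw n p.1 c} \
        ⋃ b ∈ B, (univ ×ˢ b) ∩ ⋂ d ∈ D, ({p : GaugeField P 0 (SU N) × SU N | d ∉ b} ∪
          (fun p : GaugeField P 0 (SU N) × SU N => (p.1, d)) ⁻¹' {p : GaugeField P 0 (SU N) × SU N | p.2 ∈ cm n p.1 c '' cw n p.1 c}) := by
    ext p
    simp only [mem_setOf_eq, Set.mem_sdiff, mem_iUnion, mem_inter_iff, mem_prod, mem_univ, true_and, mem_iInter, mem_union, mem_preimage,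
      hint p.1 p.2, exists_prop]
    constructor
    · rintro ⟨hT, hni⟩
      refine ⟨hT, fun ⟨b, hb, hwb, hD⟩ => hni ⟨b, hb, hwb, fun d hd hdb => ?_⟩⟩
      rcases hD d hd with h | h
      · exact absurd hdb h
      · exact h
    · rintro ⟨hT, hni⟩
      refine ⟨hT, fun ⟨b, hb, hwb, hD⟩ => hni ⟨b, hb, hwb, fun d hd => ?_⟩⟩
      by_cases hdb : d ∈ b
      · exact Or.inr (hD d hd hdb)
      · exact Or.inl hdb
  rw [hset]
  refine h1.diff (MeasurableSet.biUnion hBcount fun b hb => (MeasurableSet.univ.prod (hBbasis.isOpen hb).measurableSet).inter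
    (MeasurableSet.biInter hDcount fun d _ => (MeasurableSet.const _).union (h1.preimage (measurable_fst.prodMk measurable_const))))

/-! ## §2  The engine applied: the `v`-section of the frontier graph is `fieldMeasure`-null for EVERY `v` -/

/-- ★★★ **EDGE, GENERIC TORUS ∕ `SU(N)`**: for `n ≤ m + K` in the chart regime, every bond `c : PBond P n` and EVERY `v ∈ SU(N)`,
`fieldMeasure{z | v ∈ frontier (cm n z c '' cw n z c)} = 0` — part 1's transitivity engine at the `fieldMeasure`-preserving fine lifts of the gauge
transformations `a` concentrated at `c₋` (`T_{z^{u_a}} = a·T_z`, `a⁻¹·` transitive), fed by part 2's «Haar-null frontier for every environment» and §1.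
[cite: Balaban1987RG1, (0.4) p.253, (2.1) p.265 and (2.9) p.266] -/
theorem measure_setOf_mem_frontier_eq_zero {α : ℝ} (hα0 : 0 < α) (hα24 : α ≤ 1 / 24) (hα64 : 64 * α ≤ deltaSU (Fin N))
    (hαL : 157 * α < ((P.L : ℝ) ^ (P.d - 1))⁻¹)
    (hgap : ∀ j (c : PBond P (j + 1)), (offCard c : ℝ) / (Fintype.card (Idx P) : ℝ) + 150 * α < 1)
    (hicb0 : ∀ c, icb 0 c = c) (hicbS : ∀ n (c : PBond P (n + 1)), icb (n + 1) c = icb n (centralBond c))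
    (hcm : ∀ n U c g, cm n U c g =
      Averaging.iter (fun i => BlockAveraging.blockAvg (P := P) (j := i) (expMeanLogSU (n := Fin N))) n (update U (icb n c) g) c)
    (hcw0 : ∀ U c, cw 0 U c = univ)
    (hcwS : ∀ n U (c : PBond P (n + 1)), cw (n + 1) U c = {g | g ∈ cw n U (centralBond c) ∧
      cm n U (centralBond c) g ∈ {h : SU N | ∀ i : Idx P,
        dist1 (fibreFamily (Averaging.iter (fun i => BlockAveraging.blockAvg (P := P) (j := i) (expMeanLogSU (n := Fin N))) n U) c
          (pre (Averaging.iter (fun i => BlockAveraging.blockAvg (P := P) (j := i) (expMeanLogSU (n := Fin N))) n U) c * h *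
            post (Averaging.iter (fun i => BlockAveraging.blockAvg (P := P) (j := i) (expMeanLogSU (n := Fin N))) n U) c) i) ≤ α}})
    {n : ℕ} (hn : n ≤ P.m + P.K) (c : PBond P n) (v : SU N) :
    fieldMeasure P 0 (SU N) {z | v ∈ frontier (cm n z c '' cw n z c)} = 0 := by
  classical
  haveI : IsProbabilityMeasure (HaarData.haar : Measure (SU N)) := HaarData.isProb
  have hcl := fun z : GaugeField P 0 (SU N) =>
    isClosed_image_and_haar_diff_interior_eq_zero icb cm cw hα0 hα24 hα64 hαL hgap hicb0 hicbS hcm hcw0 hcwS hn z c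
  have hMm := measurableSet_frontierGraph icb cm cw hα0 hα24 hα64 hαL hgap hicb0 hicbS hcm hcw0 hcwS hn c
  have hset : {z : GaugeField P 0 (SU N) | v ∈ frontier (cm n z c '' cw n z c)} =
      {z | (z, v) ∈ {p : GaugeField P 0 (SU N) × SU N |
        p.2 ∈ cm n p.1 c '' cw n p.1 c ∧ p.2 ∉ interior (cm n p.1 c '' cw n p.1 c)}} := by
    ext z
    simp only [mem_setOf_eq, (hcl z).1.frontier_eq, Set.mem_sdiff]
  rw [hset]
  -- fine lifts of the gauge transformations concentrated at `c₋`
  have hlift := fun a : SU N =>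
    exists_fineLift (P := P) (fun i => BlockAveraging.blockAvg (P := P) (j := i) (expMeanLogSU (n := Fin N))) hn
      (fun y => if y = c.src then a else 1)
  choose u hu hfam using hlift
  have hne : c.tgt ≠ c.src := fun h => B12SmallFieldDomain259.src_ne_tgt c h.symm
  refine measure_section_eq_zero_of_ae_null_of_transitive (fieldMeasure P 0 (SU N)) (HaarData.haar : Measure (SU N)) hMm ?_
    (fun a => GaugeField.gaugeAct (u a)) (fun a w => a⁻¹ * w) (fun a => measurePreserving_gaugeAct (u a)) ?_ ?_ v
  · -- null sections for EVERY environment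
    refine Filter.Eventually.of_forall fun z => ?_
    have hsec : Prod.mk z ⁻¹' {p : GaugeField P 0 (SU N) × SU N |
        p.2 ∈ cm n p.1 c '' cw n p.1 c ∧ p.2 ∉ interior (cm n p.1 c '' cw n p.1 c)} =
        cm n z c '' cw n z c \ interior (cm n z c '' cw n z c) := by
      ext w; simp only [mem_preimage, mem_setOf_eq, Set.mem_sdiff]
    rw [hsec]
    exact (hcl z).2
  · -- covariance: `T_{z^{u_a}} = a · T_z`
    intro a z w
    have himg := image_cw_gaugeAct (expMeanLogSU (n := Fin N)) icb cm cw hicbS hcm hcw0 hcwS hn (u a) _ (hu a) (hfam a) z c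
    have hfun : (fun x : SU N => (if c.src = c.src then a else 1) * x * ((if c.tgt = c.src then a else 1))⁻¹) =
        (Homeomorph.mulLeft a : SU N → SU N) := by
      funext x; simp [hne]
    rw [hfun, Homeomorph.image_eq_preimage_symm] at himg
    have hT : ∀ x : SU N, x ∈ cm n (GaugeField.gaugeAct (u a) z) c '' cw n (GaugeField.gaugeAct (u a) z) c ↔
        a⁻¹ * x ∈ cm n z c '' cw n z c := by
      intro x; rw [himg, Set.mem_preimage, Homeomorph.mulLeft_symm, Homeomorph.coe_mulLeft]
    have hI : ∀ x : SU N, x ∈ interior (cm n (GaugeField.gaugeAct (u a) z) c '' cw n (GaugeField.gaugeAct (u a) z) c) ↔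
        a⁻¹ * x ∈ interior (cm n z c '' cw n z c) := by
      intro x; rw [himg, ← Homeomorph.preimage_interior, Set.mem_preimage, Homeomorph.mulLeft_symm, Homeomorph.coe_mulLeft]
    simp only [mem_setOf_eq, hT, hI]
  · -- transitivity of `w ↦ a⁻¹ · w`
    intro w w'
    exact ⟨w * w'⁻¹, by group⟩

end Generic

/-! ## §3  EDGE in the stub's letters (T³, `SU(2)`) -/

/-- ★★★ **EDGE `EdgeFlat` (LINE g18-2 `wreg_chart.lean` v15 :2304, text verbatim with `iterCentralBond` ∕ `chainMap ℰp` ∕ `chainWindow α` abstracted to the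
families `icb` ∕ `cm` ∕ `cw` under their defining recursion equations — each `rfl` for the line's definitions)**: on a three-torus `F.P K`, `G = SU(2)`, for
`n ≤ m + K` in the chart regime `0 < α ≤ 1∕24`, `64·α ≤ δ_SU(2)`, `157·α < L^{−(d−1)}`, `offCard c∕|Idx| + 150·α < 1`, every level-`n` bond `c` and every
FIXED `v ∈ SU(2)`: for `fieldMeasure`-a.e. environment `z`, `v` is NOT on the topological edge of the image window `cm n z c '' cw n z c` of the one-variable
chain.  Door fit for the line: `stub_edgeFlat := edgeFlat_of_chainEqns (fun P n => iterCentralBond n) (fun P n => chainMap ℰp n) (fun P α n => chainWindow α n)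
(fun _ _ => rfl) (fun _ _ _ => rfl) (fun _ _ _ _ _ => rfl) (fun _ _ _ _ => rfl) (fun _ _ _ _ _ => rfl)`. [cite: Balaban1987RG1, (0.4) p.253, (2.1) p.265 and (2.9) p.266] -/
theorem edgeFlat_of_chainEqns
    (icb : (P : Params) → (n : ℕ) → PBond P n → PBond P 0)
    (cm : (P : Params) → (n : ℕ) → GaugeField P 0 (Matrix.specialUnitaryGroup (Fin 2) ℂ) → PBond P n →
      Matrix.specialUnitaryGroup (Fin 2) ℂ → Matrix.specialUnitaryGroup (Fin 2) ℂ)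
    (cw : (P : Params) → (α : ℝ) → (n : ℕ) → GaugeField P 0 (Matrix.specialUnitaryGroup (Fin 2) ℂ) → PBond P n →
      Set (Matrix.specialUnitaryGroup (Fin 2) ℂ))
    (hicb0 : ∀ (P : Params) (c : PBond P 0), icb P 0 c = c)
    (hicbS : ∀ (P : Params) (n : ℕ) (c : PBond P (n + 1)), icb P (n + 1) c = icb P n (centralBond c))
    (hcm : ∀ (P : Params) (n : ℕ) (U : GaugeField P 0 (Matrix.specialUnitaryGroup (Fin 2) ℂ)) (c : PBond P n)
      (g : Matrix.specialUnitaryGroup (Fin 2) ℂ),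
      cm P n U c g = Averaging.iter (fun i => BlockAveraging.blockAvg (P := P) (j := i) ℰp) n (update U (icb P n c) g) c)
    (hcw0 : ∀ (P : Params) (α : ℝ) (U : GaugeField P 0 (Matrix.specialUnitaryGroup (Fin 2) ℂ)) (c : PBond P 0), cw P α 0 U c = univ)
    (hcwS : ∀ (P : Params) (α : ℝ) (n : ℕ) (U : GaugeField P 0 (Matrix.specialUnitaryGroup (Fin 2) ℂ)) (c : PBond P (n + 1)),
      cw P α (n + 1) U c = {g | g ∈ cw P α n U (centralBond c) ∧
        cm P n U (centralBond c) g ∈ {h : Matrix.specialUnitaryGroup (Fin 2) ℂ | ∀ i : Idx P,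
          dist1 (fibreFamily (Averaging.iter (fun i => BlockAveraging.blockAvg (P := P) (j := i) (expMeanLogSU (n := Fin 2))) n U) c
            (pre (Averaging.iter (fun i => BlockAveraging.blockAvg (P := P) (j := i) (expMeanLogSU (n := Fin 2))) n U) c * h *
              post (Averaging.iter (fun i => BlockAveraging.blockAvg (P := P) (j := i) (expMeanLogSU (n := Fin 2))) n U) c) i) ≤ α}}) :
    ∀ (F : T3Family) (K n : ℕ), n ≤ (F.P K).m + (F.P K).K → ∀ (α : ℝ), 0 < α → α ≤ 1 / 24 → 64 * α ≤ deltaSU (Fin 2) →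
      157 * α < (((F.P K).L : ℝ) ^ ((F.P K).d - 1))⁻¹ →
      (∀ j (c : PBond (F.P K) (j + 1)), (offCard c : ℝ) / (Fintype.card (Idx (F.P K)) : ℝ) + 150 * α < 1) →
      ∀ (c : PBond (F.P K) n) (v : Matrix.specialUnitaryGroup (Fin 2) ℂ),
        ∀ᵐ z ∂fieldMeasure (F.P K) 0 (Matrix.specialUnitaryGroup (Fin 2) ℂ),
          v ∉ frontier (cm (F.P K) n z c '' cw (F.P K) α n z c) := by
  intro F K n hn α hα0 hα24 hα64 hαL hgap c v
  have key := measure_setOf_mem_frontier_eq_zero (P := F.P K) (N := 2) (icb (F.P K)) (cm (F.P K)) (cw (F.P K) α)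
    hα0 hα24 hα64 hαL hgap (hicb0 (F.P K)) (hicbS (F.P K)) (fun n U c g => hcm (F.P K) n U c g) (hcw0 (F.P K) α)
    (hcwS (F.P K) α) hn c v
  rw [ae_iff]
  simpa only [not_not] using key

end Summit.QuantumFields.YangMills.Theorems.FluctuationComparisonRegPrIntLWregChartEdge

end
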